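import Summits.SmoothPoincare4.SmoothPoincare4.Theses.QuaternionicSimilarity
import Literature.Topology.FourManifolds.HomotopySpheresGroup
import Literature.Topology.FourManifolds.SmoothOrientationSphereProofs

/-!
# Skeleton-registrar check — crux `QuaternionicSimilarity.Straighten` (stmt-SmoothPoincare4-6271) AS TYPED

Planner `planner-skel-stmt-SmoothPoincare4-6271-0`, 2026-08-17. Reproduces (independently) the idea-node g12
finding (evidence `VacuityCheck.lean` on the item, 2026-08-16): the fibre clause
`p ⁻¹' {p x} = {y | (y : EuclideanSpace ℝ (Fin 8)) ∈ V}` of `Straighten` elaborates — `binrel%` coercion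
insertion, `Set ↥S⁷ ↪ Set ℝ⁸` via `Subtype.val '' ·` — as an equation in `Set (EuclideanSpace ℝ (Fin 8))`:
`Subtype.val '' (p ⁻¹' {p x}) = ↑V` (`straighten_iff_image`, `Iff.rfl`). Since `0 ∈ V` while every point of
the image has norm `1`, the clause is unsatisfiable; `S⁷ ≠ ∅` and `S⁴` is a homotopy 4-sphere, so

* `not_straighten : ¬ Straighten` — the crux is FALSE as typed (class: misstated);
* `greatFibrationBaseStandard_trivial : GreatFibrationBaseStandard` — crux #3 (stmt-6272) is VACUOUSLY TRUE as typed;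
* `not_hopfGreatFibration : ¬ HopfGreatFibration` — support stmt-6274 FALSE as typed;
* `not_target : ¬ Target` — target stmt-10629 FALSE as typed.

Consequence for BC3: no consistent stub set `stub_*` admits a real proof `Straighten_of : … → Straighten`;
an elaborating skeleton for the crux as typed would need jointly inconsistent stubs (costume). Repaired clause
(C′, elaborates in `Set ↥S⁷`, see `bc/StraightenR_birth_draft.lean`):
`p ⁻¹' {p x} = {y : Metric.sphere (0 : EuclideanSpace ℝ (Fin 8)) 1 | (y : EuclideanSpace ℝ (Fin 8)) ∈ V}`.
All proofs sorry-free; axioms `propext, Classical.choice, Quot.sound`.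
-/

open scoped Manifold ContDiff
open Summit.SmoothPoincare4.SmoothPoincare4.Theses.QuaternionicSimilarity

namespace SkelRegistrarCheck

/-- The fibre clause lives in `Set ℝ⁸`: definitional unfolding of the crux as rendered by the gate. -/
theorem straighten_iff_image : Straighten ↔ (∀ S : Literature.Topology.FourManifolds.HomotopySphere 4,
    ∃ p : Metric.sphere (0 : EuclideanSpace ℝ (Fin 8)) 1 → S.carrier,
      ContMDiff (𝓡 7) (𝓡 4) ∞ p ∧ Function.Surjective p ∧
      (∀ x, Function.Surjective (mfderiv (𝓡 7) (𝓡 4) p x)) ∧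
      ∀ x, ∃ V : Submodule ℝ (EuclideanSpace ℝ (Fin 8)), Module.finrank ℝ V = 4 ∧
        Subtype.val '' (p ⁻¹' {p x}) = (V : Set (EuclideanSpace ℝ (Fin 8)))) := Iff.rfl

/-- A point of `S⁷`. -/
theorem single_mem_sphere :
    (EuclideanSpace.single (0 : Fin 8) (1 : ℝ)) ∈ Metric.sphere (0 : EuclideanSpace ℝ (Fin 8)) 1 := by
  simp

/-- The typed fibre clause is unsatisfiable: no subset of `S⁷` has image a linear subspace of `ℝ⁸`. -/
theorem image_ne_submodule (A : Set (Metric.sphere (0 : EuclideanSpace ℝ (Fin 8)) 1))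
    (V : Submodule ℝ (EuclideanSpace ℝ (Fin 8))) :
    Subtype.val '' A ≠ (V : Set (EuclideanSpace ℝ (Fin 8))) := by
  intro hV
  have h0 : (0 : EuclideanSpace ℝ (Fin 8)) ∈ (V : Set (EuclideanSpace ℝ (Fin 8))) := V.zero_mem
  rw [← hV] at h0
  obtain ⟨y, -, hy⟩ := h0
  have hy1 : ‖(y : EuclideanSpace ℝ (Fin 8))‖ = 1 := by
    have := y.2
    rwa [Metric.mem_sphere, dist_zero_right] at this
  rw [hy, norm_zero] at hy1
  exact zero_ne_one hy1

/-- `Straighten` (stmt-SmoothPoincare4-6271) as typed is false. -/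
theorem not_straighten : ¬ Straighten := by
  intro h
  obtain ⟨o⟩ := (Literature.Topology.FourManifolds.isOrientable_sphere_holds 4 : Nonempty _)
  obtain ⟨p, -, -, -, hfib⟩ :=
    (straighten_iff_image.mp h) (Literature.Topology.FourManifolds.HomotopySphere.sphere o)
  obtain ⟨V, -, hV⟩ := hfib ⟨_, single_mem_sphere⟩
  exact image_ne_submodule _ V hV

/-- `GreatFibrationBaseStandard` (stmt-SmoothPoincare4-6272) as typed is vacuously true. -/
theorem greatFibrationBaseStandard_trivial : GreatFibrationBaseStandard := by
  intro M _ _ _ _ _ p _ _ _ hfib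
  obtain ⟨V, -, hV⟩ := hfib ⟨_, single_mem_sphere⟩
  exact absurd hV (image_ne_submodule _ V)

/-- `HopfGreatFibration` (stmt-SmoothPoincare4-6274) as typed is false. -/
theorem not_hopfGreatFibration : ¬ HopfGreatFibration := by
  rintro ⟨p, -, -, -, hfib⟩
  obtain ⟨V, -, hV⟩ := hfib ⟨_, single_mem_sphere⟩
  exact image_ne_submodule _ V hV

/-- `Target` (stmt-SmoothPoincare4-10629) as typed is false (its first conjunct is `Straighten` verbatim). -/
theorem not_target : ¬ Target := fun h => not_straighten h.1

/-- Hence the route's `closes` is currently powered by a false hypothesis: `Straighten → anything`. -/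
example : Straighten → False := not_straighten

end SkelRegistrarCheck
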